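import Summits.ResolutionOfSingularities.ResolutionOfSingularities.Theorems.InertDescentLU
import HarnessLib

/-!
# InertDescentLU (2/5) — engine, one witness UP: `(A[x])_𝔪` is integrally closed (Stacks 03GD) and Noetherian

Part 2 of the g28 node `InertDescentLU` of the ROOT/RESIDUAL decomposition cell `decomp-res` (lens 1, window
(W-inert) of critic row 207); see the module docstring of
`Summits.ResolutionOfSingularities.ResolutionOfSingularities.Theorems.InertDescentLU` (part 1/5) for the thesis, the engine
(faithfully flat descent of regularity [Matsumura 23.7 (i)] + standard-étale over normal is normal [Stacks 03GD]),
the law `UnramifiedWitnessLUAbove k O → RelLocalUniformization k K O`, the residual R28, the cuts and the sources.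
Problem side, sorry-free, hypothesis-free.

This part: `isIntegrallyClosed_locAtCentre_adjoin` (standard-étale over normal is normal, one witness, via Mathlib's
`exists_derivative_mul_eq_and_isIntegral_coeff`) and `isNoetherianRing_locAtCentre_adjoin`.
-/

noncomputable section

open IsLocalRing Polynomial Literature.AlgebraicGeometry.Resolution

namespace Summit.ResolutionOfSingularities.ResolutionOfSingularities.Theorems.InertDescentLU

universe u

variable {E : Type u} [Field E] (OE : ValuationSubring E)

/-! ## PART B — ONE WITNESS UP: `(A[x])_𝔪` is again integrally closed (Tate / Stacks 03GD, Mathlib) and Noetherian -/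

section StepUp

variable {B : Subring E} {x : E}

set_option maxHeartbeats 800000 in
/-- **Standard-étale over normal is normal, for one witness** ([EGA IV₄, 18.10.x] / [Stacks 033C] in the
frame, via Mathlib's key lemma [Stacks 03GD] `exists_derivative_mul_eq_and_isIntegral_coeff`).  `B ⊆ O_E`,
`A = B_𝔪` integrally closed with fraction field `L ⊆ E`, `x ∈ O_E` a root of a monic `f` over `B` with
`v(f′(x)) = 0`; `h` the minimal polynomial of `x` (so `h′(x)` is a unit at the centre).  Then
`A₁ = (A[x])_𝔪` is integrally closed: an element `z` of `Frac A₁ = L(x) = L[X]/(h)` integral over `A₁` has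
`s·z` integral over `A[x]`, hence over `A`, for some `s ∈ A[x]` of value `0`; by 03GD, `h′(x)·s·z ∈ A[x]`
(its coefficients are integral over `A`, hence in `A`); so `z = (h′(x) s z)/(h′(x) s) ∈ (A[x])_𝔪`. (Sources:
StacksProject, Tag 03GD.) -/
theorem isIntegrallyClosed_locAtCentre_adjoin (hBO : B ≤ OE.toSubring) (hxO : x ∈ OE)
    [IsNoetherianRing (locAtCentre B OE)] (hic : IsIntegrallyClosed (locAtCentre B OE))
    {f : E[X]} (hf : ∀ i, f.coeff i ∈ B) (hfm : f.Monic) (hfx : f.eval x = 0)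
    (hder : OE.valuation ((derivative f).eval x) = 1) :
    IsIntegrallyClosed
      (locAtCentre (Algebra.adjoin (locAtCentre B OE) ({x} : Set E)).toSubring OE) := by
  classical
  set A : Subring E := locAtCentre B OE with hAdef
  haveI : IsLocalRing A := isLocalRing_locAtCentre hBO
  haveI : IsIntegrallyClosed A := hic
  have hAO : A ≤ OE.toSubring := locAtCentre_le hBO
  have hfA : ∀ i, f.coeff i ∈ A := fun i => le_locAtCentre B OE (hf i)
  have hint : IsIntegral A x := isIntegral_of_monic_root A hfA hfm hfx
  let T : Subalgebra A E := Algebra.adjoin A ({x} : Set E)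
  set B₁ : Subring E := T.toSubring with hB₁def
  set A₁ : Subring E := locAtCentre B₁ OE with hA₁def
  have hB₁O : B₁ ≤ OE.toSubring := adjoin_toSubring_le OE hBO hxO
  have hAB₁ : A ≤ B₁ := locAtCentre_le_adjoin_toSubring OE
  have hAA₁ : A ≤ A₁ := hAB₁.trans (le_locAtCentre B₁ OE)
  have hxB₁ : x ∈ B₁ := Algebra.subset_adjoin (Set.mem_singleton x)
  have hmemB₁ : ∀ p : Polynomial A, aeval x p ∈ B₁ := fun p =>
    Polynomial.aeval_mem_adjoin_singleton A x
  -- the unit `d = h′(x)`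
  set d : E := aeval x (derivative (minpoly A x)) with hddef
  have hd : OE.valuation d = 1 :=
    valuation_aeval_derivative_minpoly_eq_one OE hBO hxO hic hf hfm hfx hder
  have hdB₁ : d ∈ B₁ := hmemB₁ _
  -- the fraction field `L = Frac A ⊆ E`
  let L : Subfield E := Subfield.closure (A : Set E)
  have hAL : A ≤ L.toSubring := fun z hz => Subfield.subset_closure hz
  letI algAL : Algebra A L := (Subring.inclusion hAL).toAlgebra
  haveI : IsScalarTower A L E := IsScalarTower.of_algebraMap_eq fun _ => rfl
  have hinjAL : Function.Injective (algebraMap A L) := fun a b hab => by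
    apply Subtype.ext
    exact congrArg (fun z : L => (z : E)) hab
  haveI : FaithfulSMul A L := (faithfulSMul_iff_algebraMap_injective A L).mpr hinjAL
  haveI : IsFractionRing A L := by
    refine IsFractionRing.of_field A L fun z => ?_
    obtain ⟨y, hy, w, hw, hyw⟩ := Subfield.mem_closure_iff.mp z.2
    rw [Subring.closure_eq] at hy hw
    exact ⟨⟨y, hy⟩, ⟨w, hw⟩, Subtype.ext hyw.symm⟩
  have hintL : IsIntegral L x := hint.tower_top
  -- `L(x) = L[x]`, a field containing `A₁`
  let F : IntermediateField L E := IntermediateField.adjoin L ({x} : Set E)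
  have hFalg : F.toSubalgebra = Algebra.adjoin L ({x} : Set E) :=
    IntermediateField.adjoin_simple_toSubalgebra_of_isAlgebraic hintL.isAlgebraic
  have hB₁F : B₁ ≤ F.toSubfield.toSubring := by
    rw [hB₁def, Algebra.adjoin_eq_ring_closure]
    refine Subring.closure_le.mpr ?_
    rintro z (⟨w, rfl⟩ | hz)
    · exact F.algebraMap_mem ⟨(w : E), hAL w.2⟩
    · rw [Set.mem_singleton_iff] at hz
      rw [hz]
      exact IntermediateField.mem_adjoin_simple_self L x
  have hA₁F : A₁ ≤ F.toSubfield.toSubring := by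
    rintro _ ⟨y, hy, z, hz, -, rfl⟩
    exact F.toSubfield.div_mem (hB₁F hy) (hB₁F hz)
  -- the `A`-algebra map `φ : L[X] → L[x]`, `X ↦ x`, with kernel `(h)`
  let φ₀ : Polynomial L →ₐ[L] (Algebra.adjoin L ({x} : Set E)) :=
    (Polynomial.aeval x).codRestrict (Algebra.adjoin L ({x} : Set E))
      (fun p => Polynomial.aeval_mem_adjoin_singleton L x)
  let φ : Polynomial L →ₐ[A] (Algebra.adjoin L ({x} : Set E)) := φ₀.restrictScalars A
  have hφval : ∀ p, ((φ p : Algebra.adjoin L ({x} : Set E)) : E) = aeval x p := fun _ => rfl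
  have hφsurj : Function.Surjective φ := by
    intro b
    have hb : (b : E) ∈ (Polynomial.aeval x : Polynomial L →ₐ[L] E).range := by
      rw [← Algebra.adjoin_singleton_eq_range_aeval]; exact b.2
    obtain ⟨p, hp⟩ := hb
    exact ⟨p, Subtype.ext hp⟩
  have hminL : minpoly L x = (minpoly A x).map (algebraMap A L) :=
    minpoly.isIntegrallyClosed_eq_field_fractions' L hint
  have hcoef : ∀ i, IsIntegral A ((minpoly L x).coeff i) := fun i => by
    rw [hminL, Polynomial.coeff_map]; exact isIntegral_algebraMap
  have hker : RingHom.ker φ.toRingHom = Ideal.span {minpoly L x} := by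
    ext p
    rw [RingHom.mem_ker]
    have h1 : φ.toRingHom p = 0 ↔ aeval x p = 0 := by
      constructor
      · intro h0
        have := congrArg (fun b : Algebra.adjoin L ({x} : Set E) => (b : E)) h0
        simpa [hφval] using this
      · intro h0
        apply Subtype.ext
        change ((φ p : Algebra.adjoin L ({x} : Set E)) : E) = 0
        rw [hφval, h0]
    rw [h1, ← RingHom.mem_ker (f := (Polynomial.aeval x : Polynomial L →ₐ[L] E)),
      minpoly.ker_aeval_eq_span_minpoly]
  -- KEY (03GD): `h′(x) · y ∈ A[x]` for `y ∈ L[x]` integral over `A`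
  have hkey : ∀ y : Algebra.adjoin L ({x} : Set E), IsIntegral A y → d * (y : E) ∈ B₁ := by
    intro y hy
    obtain ⟨g, hg, hgint⟩ :=
      exists_derivative_mul_eq_and_isIntegral_coeff hφsurj (minpoly.monic hintL) hcoef hker hy
    have hgl : g ∈ Polynomial.lifts (algebraMap A L) := by
      rw [Polynomial.lifts_iff_coeff_lifts]
      intro i
      obtain ⟨a, ha⟩ := (IsIntegrallyClosed.isIntegral_iff (R := A) (K := L)).mp (hgint i)
      exact ⟨a, ha⟩
    obtain ⟨g₀, hg₀⟩ := (Polynomial.mem_lifts g).mp hgl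
    have h1 := congrArg (fun b : Algebra.adjoin L ({x} : Set E) => (b : E)) hg
    simp only [Subalgebra.coe_mul, hφval] at h1
    have h2 : aeval x (derivative (minpoly L x)) = d := by
      rw [hminL, Polynomial.derivative_map, Polynomial.aeval_map_algebraMap]
    have h3 : aeval x g = aeval x g₀ := by
      rw [← hg₀, Polynomial.aeval_map_algebraMap]
    rw [h2, h3] at h1
    rw [h1]
    exact hmemB₁ g₀
  -- `A[x]` is integral over `A`
  have hTint : T ≤ integralClosure A E := by
    refine Algebra.adjoin_le ?_
    rintro _ rfl
    exact hint
  letI algAB₁ : Algebra A B₁ := (Subring.inclusion hAB₁).toAlgebra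
  haveI : IsScalarTower A B₁ E := IsScalarTower.of_algebraMap_eq fun _ => rfl
  haveI : Algebra.IsIntegral A B₁ := by
    refine ⟨fun b => ?_⟩
    have hbE : IsIntegral A (b : E) := hTint b.2
    exact (isIntegral_algHom_iff (IsScalarTower.toAlgHom A B₁ E) Subtype.val_injective).mp hbE
  -- the fraction field `L₁ = Frac A₁ ⊆ L(x)` and the conclusion
  let L₁ : Subfield E := Subfield.closure (A₁ : Set E)
  have hA₁L₁ : A₁ ≤ L₁.toSubring := fun z hz => Subfield.subset_closure hz
  have hB₁L₁ : B₁ ≤ L₁.toSubring := (le_locAtCentre B₁ OE).trans hA₁L₁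
  have hL₁F : L₁ ≤ F.toSubfield := Subfield.closure_le.mpr hA₁F
  letI algA₁L₁ : Algebra A₁ L₁ := (Subring.inclusion hA₁L₁).toAlgebra
  letI algB₁L₁ : Algebra B₁ L₁ := (Subring.inclusion hB₁L₁).toAlgebra
  letI algAL₁ : Algebra A L₁ := (Subring.inclusion (hAA₁.trans hA₁L₁)).toAlgebra
  haveI : IsScalarTower B₁ A₁ L₁ := IsScalarTower.of_algebraMap_eq fun _ => rfl
  haveI : IsScalarTower A B₁ L₁ := IsScalarTower.of_algebraMap_eq fun _ => rfl
  haveI : IsScalarTower A L₁ E := IsScalarTower.of_algebraMap_eq fun _ => rfl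
  have hinj₁ : Function.Injective (algebraMap A₁ L₁) := fun a b hab => by
    apply Subtype.ext
    exact congrArg (fun z : L₁ => (z : E)) hab
  haveI : FaithfulSMul A₁ L₁ := (faithfulSMul_iff_algebraMap_injective A₁ L₁).mpr hinj₁
  haveI : IsFractionRing A₁ L₁ := by
    refine IsFractionRing.of_field A₁ L₁ fun z => ?_
    obtain ⟨y, hy, w, hw, hyw⟩ := Subfield.mem_closure_iff.mp z.2
    rw [Subring.closure_eq] at hy hw
    exact ⟨⟨y, hy⟩, ⟨w, hw⟩, Subtype.ext hyw.symm⟩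
  haveI := isLocalization_locAtCentre (O := OE) hB₁O
  refine (isIntegrallyClosed_iff L₁).mpr (fun {z} hz => ?_)
  -- `s • z` is integral over `A[x]`, hence over `A`, for some `s ∈ A[x]` off the centre
  obtain ⟨⟨s, hs⟩, hsz⟩ :=
    IsIntegral.exists_multiple_integral_of_isLocalization (subringCentre B₁ OE hB₁O).primeCompl
      (Rₘ := A₁) z hz
  have hvs : OE.valuation ((s : B₁) : E) = 1 := valuation_eq_one_of_not_mem_subringCentre hB₁O hs
  have hszA : IsIntegral A ((⟨s, hs⟩ : (subringCentre B₁ OE hB₁O).primeCompl) • z) :=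
    isIntegral_trans _ hsz
  have hszE : IsIntegral A (((s : B₁) : E) * (z : E)) := by
    have h := hszA.map (IsScalarTower.toAlgHom A L₁ E)
    have hval : ((((⟨s, hs⟩ : (subringCentre B₁ OE hB₁O).primeCompl) • z : L₁)) : E) =
        ((s : B₁) : E) * (z : E) := by
      rw [Submonoid.smul_def, Algebra.smul_def]; rfl
    rw [show (IsScalarTower.toAlgHom A L₁ E) _ = ((((⟨s, hs⟩ :
      (subringCentre B₁ OE hB₁O).primeCompl) • z : L₁)) : E) from rfl, hval] at h
    exact h
  -- `s z ∈ L(x) = L[x]`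
  have hszF : ((s : B₁) : E) * (z : E) ∈ Algebra.adjoin L ({x} : Set E) := by
    have h1 : ((s : B₁) : E) * (z : E) ∈ F :=
      mul_mem (hB₁F (s : B₁).2) (hL₁F z.2)
    rw [← IntermediateField.mem_toSubalgebra, hFalg] at h1
    exact h1
  have hyint : IsIntegral A (⟨((s : B₁) : E) * (z : E), hszF⟩ : Algebra.adjoin L ({x} : Set E)) :=
    (isIntegral_algHom_iff ((Algebra.adjoin L ({x} : Set E)).val.restrictScalars A)
      Subtype.val_injective).mp hszE
  have hmem : d * (((s : B₁) : E) * (z : E)) ∈ B₁ := hkey _ hyint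
  -- `z = (d s z)/(d s) ∈ (A[x])_𝔪`
  have hds : OE.valuation (d * ((s : B₁) : E)) = 1 := by rw [map_mul, hd, hvs, one_mul]
  have hds0 : d * ((s : B₁) : E) ≠ 0 := ne_zero_of_valuation_eq_one hds
  have hzA₁ : (z : E) ∈ A₁ := by
    refine mem_locAtCentre_iff.mpr ⟨_, hmem, d * ((s : B₁) : E), mul_mem hdB₁ (s : B₁).2, hds, ?_⟩
    rw [eq_div_iff hds0]
    ring
  exact ⟨⟨(z : E), hzA₁⟩, Subtype.ext rfl⟩


/-- Noetherianity goes UP one witness: `(A[x])_𝔪` is Noetherian when `A = B_𝔪` is (Hilbert basis theorem and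
localization). [folklore] -/
theorem isNoetherianRing_locAtCentre_adjoin (hBO : B ≤ OE.toSubring) (hxO : x ∈ OE)
    [IsNoetherianRing (locAtCentre B OE)] :
    IsNoetherianRing (locAtCentre (Algebra.adjoin (locAtCentre B OE) ({x} : Set E)).toSubring OE) := by
  classical
  haveI : IsNoetherianRing (Algebra.adjoin (locAtCentre B OE) ({x} : Set E)).toSubring :=
    isNoetherianRing_toSubring_of_fg (Algebra.adjoin (locAtCentre B OE) ({x} : Set E))
      ⟨{x}, by rw [Finset.coe_singleton]⟩
  exact isNoetherianRing_locAtCentre OE (adjoin_toSubring_le OE hBO hxO)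

end StepUp

end Summit.ResolutionOfSingularities.ResolutionOfSingularities.Theorems.InertDescentLU

end
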